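/-
Copyright (c) 2026 the pub-hodgecm-mathlib formalisation cell (harness21).  Prover seat hodgecm-mathlib-R90-C131-p02 (g0) (R90-TF S4 hand lent to L1
by CHAIR VALVE WORD W4), Track B «K2-LIT», hLiu418 = `stmt-HodgeConjecture-24832`; K1-a♮ line lead K2E5-p16 (g8) WORD #11 (α).  THEOREMS ONLY (no `def`,
no instance, no notation, no named-fact hypothesis, no `sorry`); lane `--supports stmt-HodgeConjecture-24832 --as helper`.
-/
import Summits.HodgeConjecture.HodgeConjecture.Theorems.K2LiuHermTwoEtaRankOneLetter   -- ★ ED. 3a (the letter `J`; brings Mathlib)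
import HarnessLib

/-!
# Crux `HLiu418`, (K1a-3-arch): the continued rank-one letter IN CLOSED FORM — `N`-fold integration by parts
# `Φ_N(α₀,β₀,p,s) = Σ_{j≤N} (−1)^j C(N,j) p^{N−j} ∏_{i<j}(α₀+s−2−i) · Γ(β₀+N+s−1)⁻¹ J_{p,·}(α₀−j+s, β₀+N+s)` on `{1 − N < re(β₀+s)}`

Cell `hodgecm-mathlib`, crux item hLiu418 = `stmt-HodgeConjecture-24832` (helper lane, count-neutral).  ★ (ii) `exists_continuation_jIntegral_param`
(p863550) produces the continued letter `Φ_N` abstractly, with (b) agreement with `Γ(β₀+s−1)⁻¹J` on `{1 < re(β₀+s)}` and (c) the three-term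
recursion on the whole strip.  (b)+(c) alone FORCE a closed form: unrolling (c) `m` times is a binomial expansion (Pascal), and after `N` steps every
term sits in the region where (b) applies.  Hence the continued scalar-type arch letter (★ p863574) is an EXPLICIT finite combination of CONVERGENT
letters `J`, and ★ `K2LiuHermTwoEtaRankOneGrowth` bounds it polynomially in the index size with explicit constants (K2E4-p10's decay binder `hAcb`).
* §1 **`unroll`** — for any `Φ` with (c): `Φ α₀ β₀ p s = Σ_{j<m+1} ((−1)^j·C(m,j)·p^{m−j}·∏_{i<j}(α₀+s−2−i)) · Φ (α₀−j) (β₀+m) p s` (every `m`, `s` in the strip);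
* §2 **`continuation_unrolled`** — with (b) as well, at `m = N`: the closed form by convergent letters.

HONEST LABEL: algebra of the continuation; closes no socket.  HC_CM is proved only modulo the 7 printed citations (2 remaining named inputs: hLiu418 =
`stmt-HodgeConjecture-24832`, h413 = `stmt-HodgeConjecture-24833`) until rung 0 closes.  REL ≠ ★ ≠ BUILT.

## References
* [Shimura1982] G. Shimura, *Confluent hypergeometric functions on tube domains*, Math. Ann. 260 (1982), §3 (3.6)–(3.8), Thm. 3.1.
* [Shimura1997] G. Shimura, *Euler Products and Eisenstein Series*, CBMS 93 (1997), §18.4–18.5.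
-/

set_option autoImplicit false
set_option linter.dupNamespace false

noncomputable section

open Complex MeasureTheory Set Finset

namespace Summit.HodgeConjecture.HodgeConjecture.Cruxes.HLiu418.K2LiuHermTwoEtaRankOneUnrolled

/-! ## §1 Unrolling the recursion: a binomial expansion -/

/-- **UNROLLING THE THREE-TERM RECURSION** (Pascal): if `Φ α₀ β₀ p s = p·Φ α₀ (β₀+1) p s − (α₀+s−2)·Φ (α₀−1) (β₀+1) p s` whenever `1 − N < re(β₀+s)`
(`p > 0`), then for every `m`, on the same strip,
`Φ α₀ β₀ p s = Σ_{j<m+1} ((−1)^j·C(m,j)·p^{m−j}·∏_{i<j}(α₀+s−2−i)) · Φ (α₀−j) (β₀+m) p s`. [Shimura1982, §3 (3.6)–(3.8)] -/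
theorem unroll (N : ℕ) (Φ : ℂ → ℂ → ℝ → ℂ → ℂ)
    (hc : ∀ (α₀ β₀ : ℂ) (p : ℝ), 0 < p → ∀ s : ℂ, 1 - (N : ℝ) < (β₀ + s).re →
      Φ α₀ β₀ p s = (p : ℂ) * Φ α₀ (β₀ + 1) p s - (α₀ + s - 2) * Φ (α₀ - 1) (β₀ + 1) p s)
    (m : ℕ) :
    ∀ (α₀ β₀ : ℂ) (p : ℝ), 0 < p → ∀ s : ℂ, 1 - (N : ℝ) < (β₀ + s).re →
      Φ α₀ β₀ p s = ∑ j ∈ range (m + 1),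
        ((-1) ^ j * ((m.choose j : ℕ) : ℂ) * (p : ℂ) ^ (m - j) * ∏ i ∈ range j, (α₀ + s - 2 - i)) * Φ (α₀ - j) (β₀ + m) p s := by
  induction m with
  | zero =>
    intro α₀ β₀ p hp s hs
    simp
  | succ m ih =>
    intro α₀ β₀ p hp s hs
    have hs1 : 1 - (N : ℝ) < (β₀ + 1 + s).re := by simp only [add_re, one_re] at hs ⊢; linarith
    have h1 := ih α₀ (β₀ + 1) p hp s hs1
    have h2 := ih (α₀ - 1) (β₀ + 1) p hp s hs1
    rw [hc α₀ β₀ p hp s hs, h1, h2]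
    -- spell the parameters uniformly
    have eβ : β₀ + 1 + (m : ℂ) = β₀ + ((m + 1 : ℕ) : ℂ) := by push_cast; ring
    have eα : ∀ j : ℕ, α₀ - 1 - (j : ℂ) = α₀ - ((j + 1 : ℕ) : ℂ) := fun j => by push_cast; ring
    simp only [eβ, eα]
    -- the two halves of Pascal
    -- (A) the `C(m, j)`-terms with `Φ (α₀ − j)`: `p · Σ_j c_{m,j}(α₀) Φ(α₀−j)`
    have hA : (p : ℂ) * ∑ j ∈ range (m + 1), ((-1) ^ j * ((m.choose j : ℕ) : ℂ) * (p : ℂ) ^ (m - j) * ∏ i ∈ range j, (α₀ + s - 2 - i)) *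
          Φ (α₀ - j) (β₀ + ((m + 1 : ℕ) : ℂ)) p s =
        ∑ j ∈ range (m + 1), ((-1) ^ j * ((m.choose j : ℕ) : ℂ) * (p : ℂ) ^ (m + 1 - j) * ∏ i ∈ range j, (α₀ + s - 2 - i)) *
          Φ (α₀ - j) (β₀ + ((m + 1 : ℕ) : ℂ)) p s := by
      rw [mul_sum]
      refine sum_congr rfl fun j hj => ?_
      have hjm : j ≤ m := Nat.lt_succ_iff.mp (mem_range.mp hj)
      rw [show m + 1 - j = (m - j) + 1 from by omega, pow_succ]
      ring
    -- (B) the `C(m, j)`-terms with `Φ (α₀ − (j+1))`: `−(α₀+s−2) · Σ_j c_{m,j}(α₀−1) Φ(α₀−(j+1))`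
    have hB : -((α₀ + s - 2) * ∑ j ∈ range (m + 1), ((-1) ^ j * ((m.choose j : ℕ) : ℂ) * (p : ℂ) ^ (m - j) * ∏ i ∈ range j, (α₀ - 1 + s - 2 - i)) *
          Φ (α₀ - ((j + 1 : ℕ) : ℂ)) (β₀ + ((m + 1 : ℕ) : ℂ)) p s) =
        ∑ j ∈ range (m + 1), ((-1) ^ (j + 1) * ((m.choose j : ℕ) : ℂ) * (p : ℂ) ^ (m + 1 - (j + 1)) * ∏ i ∈ range (j + 1), (α₀ + s - 2 - i)) *
          Φ (α₀ - ((j + 1 : ℕ) : ℂ)) (β₀ + ((m + 1 : ℕ) : ℂ)) p s := by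
      rw [mul_sum, ← sum_neg_distrib]
      refine sum_congr rfl fun j _ => ?_
      have hprod : ∏ i ∈ range (j + 1), (α₀ + s - 2 - (i : ℂ)) = (∏ i ∈ range j, (α₀ - 1 + s - 2 - (i : ℂ))) * (α₀ + s - 2) := by
        rw [prod_range_succ']
        congr 1
        · refine prod_congr rfl fun i _ => ?_
          push_cast; ring
        · push_cast; ring
      rw [hprod, Nat.add_sub_add_right, pow_succ]
      ring
    -- the target, peeled at `j = 0` and split by Pascal
    symm
    rw [sum_range_succ']
    have hsplit : ∑ j ∈ range (m + 1), ((-1) ^ (j + 1) * (((m + 1).choose (j + 1) : ℕ) : ℂ) * (p : ℂ) ^ (m + 1 - (j + 1)) *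
          ∏ i ∈ range (j + 1), (α₀ + s - 2 - i)) * Φ (α₀ - ((j + 1 : ℕ) : ℂ)) (β₀ + ((m + 1 : ℕ) : ℂ)) p s =
        ∑ j ∈ range (m + 1), ((-1) ^ (j + 1) * ((m.choose j : ℕ) : ℂ) * (p : ℂ) ^ (m + 1 - (j + 1)) * ∏ i ∈ range (j + 1), (α₀ + s - 2 - i)) *
          Φ (α₀ - ((j + 1 : ℕ) : ℂ)) (β₀ + ((m + 1 : ℕ) : ℂ)) p s +
        ∑ j ∈ range (m + 1), ((-1) ^ (j + 1) * ((m.choose (j + 1) : ℕ) : ℂ) * (p : ℂ) ^ (m + 1 - (j + 1)) * ∏ i ∈ range (j + 1), (α₀ + s - 2 - i)) *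
          Φ (α₀ - ((j + 1 : ℕ) : ℂ)) (β₀ + ((m + 1 : ℕ) : ℂ)) p s := by
      rw [← sum_add_distrib]
      refine sum_congr rfl fun j _ => ?_
      rw [Nat.choose_succ_succ, Nat.cast_add]
      ring
    -- the `C(m, j+1)`-terms together with the `j = 0` term re-assemble `(A)`
    have hg : ∑ j ∈ range (m + 1), ((-1) ^ (j + 1) * ((m.choose (j + 1) : ℕ) : ℂ) * (p : ℂ) ^ (m + 1 - (j + 1)) * ∏ i ∈ range (j + 1), (α₀ + s - 2 - i)) *
          Φ (α₀ - ((j + 1 : ℕ) : ℂ)) (β₀ + ((m + 1 : ℕ) : ℂ)) p s +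
        ((-1) ^ 0 * (((m + 1).choose 0 : ℕ) : ℂ) * (p : ℂ) ^ (m + 1 - 0) * ∏ i ∈ range 0, (α₀ + s - 2 - i)) *
          Φ (α₀ - ((0 : ℕ) : ℂ)) (β₀ + ((m + 1 : ℕ) : ℂ)) p s =
        ∑ j ∈ range (m + 1), ((-1) ^ j * ((m.choose j : ℕ) : ℂ) * (p : ℂ) ^ (m + 1 - j) * ∏ i ∈ range j, (α₀ + s - 2 - i)) *
          Φ (α₀ - j) (β₀ + ((m + 1 : ℕ) : ℂ)) p s := by
      -- `Σ_{j<m+2} g j` computed both ways (`g (m+1) = 0` since `C(m, m+1) = 0`)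
      have h := sum_range_succ' (fun j => ((-1) ^ j * ((m.choose j : ℕ) : ℂ) * (p : ℂ) ^ (m + 1 - j) * ∏ i ∈ range j, (α₀ + s - 2 - i)) *
          Φ (α₀ - j) (β₀ + ((m + 1 : ℕ) : ℂ)) p s) (m + 1)
      rw [sum_range_succ, Nat.choose_succ_self, Nat.cast_zero] at h
      simp only [mul_zero, zero_mul, add_zero, Nat.choose_zero_right, Nat.cast_succ, Nat.cast_zero] at h ⊢
      rw [h]
    rw [hsplit]
    linear_combination -hB + hg - hA

/-! ## §2 The closed form of the continued letter -/

/-- **THE CONTINUED RANK-ONE LETTER IN CLOSED FORM.**  If `Φ` satisfies ★ (ii)(b) (agreement with `Γ(β₀+s−1)⁻¹J_{p,t}(α₀+s,β₀+s)` on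
`{1 < re(β₀+s)}`) and ★ (ii)(c) (the recursion on `{1 − N < re(β₀+s)}`), then on the WHOLE strip `{1 − N < re(β₀+s)}` (`p > 0`):
`Φ α₀ β₀ p s = Σ_{j<N+1} ((−1)^j·C(N,j)·p^{N−j}·∏_{i<j}(α₀+s−2−i)) · (Γ(β₀+N+s−1)⁻¹ · ∫₀^∞ e^{−pr}(r+2t)^{α₀−j+s−2}r^{β₀+N+s−2}dr)` — a finite combination of
CONVERGENT letters (`re(β₀+N+s) > 1`).  [Shimura1982, §3 Thm. 3.1] [Shimura1997, §18.4] -/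
theorem continuation_unrolled {t : ℝ} (N : ℕ) (Φ : ℂ → ℂ → ℝ → ℂ → ℂ)
    (hb : ∀ (α₀ β₀ : ℂ) (p : ℝ), 0 < p → ∀ s : ℂ, 1 < (β₀ + s).re → Φ α₀ β₀ p s = (Complex.Gamma (β₀ + s - 1))⁻¹ *
      ∫ r in Ioi (0 : ℝ), cexp (-((p * r : ℝ) : ℂ)) * ((((r + 2 * t : ℝ)) : ℂ) ^ (α₀ + s - 2) * ((r : ℝ) : ℂ) ^ (β₀ + s - 2)))
    (hc : ∀ (α₀ β₀ : ℂ) (p : ℝ), 0 < p → ∀ s : ℂ, 1 - (N : ℝ) < (β₀ + s).re →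
      Φ α₀ β₀ p s = (p : ℂ) * Φ α₀ (β₀ + 1) p s - (α₀ + s - 2) * Φ (α₀ - 1) (β₀ + 1) p s)
    (α₀ β₀ : ℂ) {p : ℝ} (hp : 0 < p) {s : ℂ} (hs : 1 - (N : ℝ) < (β₀ + s).re) :
    Φ α₀ β₀ p s = ∑ j ∈ range (N + 1),
      ((-1) ^ j * ((N.choose j : ℕ) : ℂ) * (p : ℂ) ^ (N - j) * ∏ i ∈ range j, (α₀ + s - 2 - i)) *
        ((Complex.Gamma (β₀ + N + s - 1))⁻¹ *
          ∫ r in Ioi (0 : ℝ), cexp (-((p * r : ℝ) : ℂ)) * ((((r + 2 * t : ℝ)) : ℂ) ^ (α₀ - j + s - 2) * ((r : ℝ) : ℂ) ^ (β₀ + N + s - 2))) := by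
  rw [unroll N Φ hc N α₀ β₀ p hp s hs]
  refine sum_congr rfl fun j _ => ?_
  have hsN : 1 < (β₀ + (N : ℂ) + s).re := by
    simp only [add_re, natCast_re] at hs ⊢; linarith
  rw [hb (α₀ - j) (β₀ + N) p hp s hsN]

end Summit.HodgeConjecture.HodgeConjecture.Cruxes.HLiu418.K2LiuHermTwoEtaRankOneUnrolled

end
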